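import Summits.HodgeConjecture.HodgeCM.Model.HypCensus.ArchFactor_1
import Literature.NumberTheory.Automorphic.UnitaryGroupArchDet
import Literature.NumberTheory.Automorphic.UnitaryGroupArchCenter
import Literature.NumberTheory.Automorphic.UnitaryGroupAdelicCenter
import HarnessLib

/-!
# P4-S4′(ii), archimedean input (A): for a hermitian LINE `W` the archimedean torus `U(W)(E ⊗ ℝ)` IS the archimedean
# centre of `U(V)`, so «`Φ_∞` is `U(W)(E⊗ℝ)`-fixed under `archWeilRep s`» reduces to «the centre of `U(V)(E⊗ℝ)` fixes `Φ_∞`»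

Topic: summit `HodgeConjecture`, sub-problem `HodgeConjecture`, crux H413 (stmt-HodgeConjecture-24833), FLOOR-0 programme P4,
line `Cruxes/H413/Lines/F0_P4AdmissibleOccursInH1.lean`, stub S4′ `stub_T3a_holThetaRealisationOfRallisAt`, NON-VANISHING half
(seat (ii)).  Namespace `Summit.HodgeConjecture.HodgeConjecture.Cruxes.H413.ThetaNonvanishing` (as ★ `H413ThetaPairRepArchFinFactorisation`).
KERNEL: theorems only, generic in the quadratic extension `E/F`, the Gram data and the compatible splitting `s`.

The head ★ `ThetaNonvanishing.thetaLift_charCM_tmul_ne_zero_of_finCoeff_ne_zero` (seat (ii) memo `SEAT-ii-MEMO-S4ii.v1` (A)) asks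
for `heig : ∀ a : U(J_W)(E⊗ℝ), archWeilRep … s hs (1, a) Φ_∞ = χ_∞ a • Φ_∞`, and with Liu's `χ ∈ Chi` the archimedean character
is trivial (★ `Liu2021/Def411ChiAutomorphicQuotient.conj_coe_chiQuot_mk`), so `Φ_∞` must be FIXED by `U(J_W)(E⊗ℝ)`.  For a LINE
`W` (`M = 1`, `J_W ∈ M₁(E)` invertible) this file reduces that to a statement about the CENTRE of `U(J_V)`:

* §1 `U(J_W)(E⊗ℝ)` is the archimedean torus: `archCenter 1 J_W (archDet g) = g` (`archCenter_archDet_line`; a `1 × 1` matrix is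
  its determinant), hence `archCenter 1 J_W` is onto (`archCenter_line_surjective`);
* §2 in `G₁(𝔸_F) = U(J_V ⊗ J_W)(𝔸_F)` the pair elements `1 ⊗ g_∞` and `(det_∞ g · 1_V)_∞ ⊗ 1` COINCIDE
  (`adelicInr_archToAdelic_line`: ★ `UnitaryGroup.archToAdelic_archCenter` on both sides + the anti-diagonal identity
  ★ `adelicInl_adelicCenter_inv_mul_adelicInr_adelicCenter`), so the pair splitting `s_pair = s ∘ (a, b ↦ (a ⊗ 1)(1 ⊗ b))` takes the same
  value at `(1, g_∞)` and `((det_∞ g) · 1_V, 1)` (`pairSplitting_one_archToAdelic_line`) — NO scalar appears (contrast the model's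
  twisted slots, ★ `HodgeCM.Model.ArchSideTerm.lineRepOf_zero_one_center`, where the see-saw characters contribute `torusScalar`);
* §3 hence the archimedean Weil representation ★ `HodgeCM.Model.HypCensus.archWeilRep … s hs` (`= archPart ω(s_pair ·)`, ★
  `Weil1964.archRepMp_apply`) satisfies **`archWeilRep (1, g) = archWeilRep (archCenter N J_V (archDet g), 1)`**
  (`archWeilRep_one_line`);
* §4 the consumer forms: if the archimedean centre of `U(J_V)` acts on `Φ_∞` by a character `χ_c` of `U(1)(F⊗ℝ)`
  (`∀ y, archWeilRep (archCenter N J_V y, 1) Φ_∞ = χ_c y • Φ_∞`) then `heig` holds with `χ_∞ := χ_c ∘ det_∞`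
  (`archWeilRep_one_line_eq_smul_of_center`), and if the centre FIXES `Φ_∞` then so does all of `U(J_W)(E⊗ℝ)`
  (`archWeilRep_one_line_eq_self_of_center`, `heig` with `χ_∞ = 1`: `…_eq_one_smul_of_center`).

What this leaves for (A) at the pin of [Liu2021, Prop. 4.13] (`N = 3`, `F = L⁺`, `E = L`, `J_W = J_W(a)`, `s = s_μ(a)`): the action of
the archimedean CENTRE `t · 1_V`, `t ∈ U(1)(L⁺⊗ℝ)`, on the pinned harmonic vector — on the Gaussian it is ★
`Liu2021/Def411WeilCarriersCentralTypeGaussian.pairRep_chiSplittingLine_toHeckeCharacter_center_gaussianV_tmul_cm` (character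
`archWeight L (centralType (weightOneType Φ_μ))`), at `ι₁` the cotangent `K`-type is trivial on the centre (★
`HodgeCM.Model.ArchSideTerm.weightOf_blockK_centralK`), and in the model road it is ★ (CF_k) of `HodgeCM/Model/ArchKTypeOfCentralWeightPin`.
HC_CM is proved only modulo the printed citations until rung 0 closes; this file proves nothing printed.

## References
* [BorelJacquet1979] A. Borel, H. Jacquet, *Automorphic forms and automorphic representations*, PSPM 33.1 (1979), §4.1
  (`G(𝔸) = G_∞ × G(𝔸_f)`; the archimedean component inclusion).
* [GelbartRogawski1991] S. Gelbart, J. Rogawski, Invent. Math. 105 (1991), §3.1 p. 454–455 (the pair `U(V) × U(W) → U(V ⊗ W)`), §3.2 p. 457.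
* [Weil1964] A. Weil, Acta Math. 111 (1964), Chap. III n° 37–38 (`𝐫_𝐀 = ⊗_v 𝐫_v`).
* [Liu2021] Y. Liu, Camb. J. Math. 9 (2021), App. D §D.1 Step 3 (l. 5219–5221): the centre of `U(V)` acts through `χ`; Lem. D.2.
* [Mok2014] C. P. Mok, Mem. AMS 235 (2015), §1 Notation p. 5 (the centre `E¹ · 1_N` of `U(N)`).
-/

set_option autoImplicit false

-- the mandated namespace repeats the single-problem summit's segment (`HodgeConjecture.HodgeConjecture`)
set_option linter.dupNamespace false

noncomputable section

open NumberField IsDedekindDomain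
open scoped TensorProduct SchwartzMap Matrix Classical
open Literature.NumberTheory.Automorphic Literature.NumberTheory.Weil1964
open Literature.NumberTheory.GelbartRogawski1991 Literature.NumberTheory.GelbartRogawski1991.UnitaryDualPair
open HodgeCM.Model.HypCensus

namespace Summit.HodgeConjecture.HodgeConjecture.Cruxes.H413.ThetaNonvanishing

variable (F E : Type) [Field F] [NumberField F] [Field E] [NumberField E] [Algebra F E] (c : E ≃ₐ[F] E)
  (h2 : Module.finrank F E = 2) (hc : c ≠ 1)
  (N : ℕ) (JV : Matrix (Fin N) (Fin N) E) (JW : Matrix (Fin 1) (Fin 1) E)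

/-! ## §1 `U(J_W)(E ⊗ ℝ)` for a line is the archimedean torus `U(1)(F ⊗ ℝ)` -/

/-- **a `1 × 1` archimedean unitary matrix is the central element of its determinant**:
`archCenter 1 J_W (archDet g) = g`. [cite: BorelJacquet1979, §4.1] [cite: Mok2014, §1 Notation p. 5] -/
theorem archCenter_archDet_line (hJW : JW.det ≠ 0) (g : UnitaryGroup.arch F E c 1 JW) :
    UnitaryGroup.archCenter F E c 1 JW h2 hc (UnitaryGroup.archDet F E c 1 JW h2 hc hJW g) = g := by
  apply Subtype.ext
  apply Units.ext
  rw [UnitaryGroup.coe_archCenter, UnitaryGroup.coe_archDet, UnitaryGroup.coe_archDetInf, RingEquiv.apply_symm_apply,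
    Matrix.det_fin_one]
  refine Matrix.ext fun i j => ?_
  rw [Subsingleton.elim i 0, Subsingleton.elim j 0, Matrix.smul_apply, Matrix.one_apply_eq, smul_eq_mul, mul_one]

/-- hence the archimedean centre map `y ↦ y · 1₁ : U(1)(F ⊗ ℝ) →* U(J_W)(E ⊗ ℝ)` of a line is ONTO.
[cite: BorelJacquet1979, §4.1] [cite: Mok2014, §1 Notation p. 5] -/
theorem archCenter_line_surjective (hJW : JW.det ≠ 0) : Function.Surjective (UnitaryGroup.archCenter F E c 1 JW h2 hc) :=
  fun g => ⟨_, archCenter_archDet_line F E c h2 hc JW hJW g⟩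

/-! ## §2 In `G₁(𝔸_F) = U(J_V ⊗ J_W)(𝔸_F)`: `1 ⊗ g_∞ = (det_∞ g · 1_V)_∞ ⊗ 1` -/

omit [NumberField F] in
/-- **the adelic anti-diagonal identity, solved**: `1 ⊗ (u · 1_W) = (u · 1_V) ⊗ 1` in `G₁(𝔸_F)` for every norm-one idèle `u`.
[cite: GelbartRogawski1991, §3.1 p. 454–455] [cite: Mok2014, §1 Notation p. 5] -/
theorem adelicInr_adelicCenter_eq_adelicInl (M : ℕ) (JW' : Matrix (Fin M) (Fin M) E) (u : UnitaryGroup.adelicOne F E c) :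
    UnitaryGroup.adelicInr F E c N M JV JW' (UnitaryGroup.adelicCenter F E c M JW' u) =
      UnitaryGroup.adelicInl F E c N M JV JW' (UnitaryGroup.adelicCenter F E c N JV u) := by
  have h := UnitaryGroup.adelicInl_adelicCenter_inv_mul_adelicInr_adelicCenter F E c N M JV JW' u
  rw [map_inv, map_inv, inv_mul_eq_one] at h
  exact h.symm

/-- **`1 ⊗ g_∞ = (det_∞ g · 1_V)_∞ ⊗ 1` in `G₁(𝔸_F)`** for every `g ∈ U(J_W)(E ⊗ ℝ)`, `W` a line.
[cite: GelbartRogawski1991, §3.1 p. 454–455] [cite: BorelJacquet1979, §4.1] -/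
theorem adelicInr_archToAdelic_line (hJW : JW.det ≠ 0) (g : UnitaryGroup.arch F E c 1 JW) :
    UnitaryGroup.adelicInr F E c N 1 JV JW (UnitaryGroup.archToAdelic F E c 1 JW g) =
      UnitaryGroup.adelicInl F E c N 1 JV JW (UnitaryGroup.archToAdelic F E c N JV
        (UnitaryGroup.archCenter F E c N JV h2 hc (UnitaryGroup.archDet F E c 1 JW h2 hc hJW g))) := by
  conv_lhs => rw [← archCenter_archDet_line F E c h2 hc JW hJW g]
  rw [UnitaryGroup.archToAdelic_archCenter, UnitaryGroup.archToAdelic_archCenter]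
  exact adelicInr_adelicCenter_eq_adelicInl F E c N JV 1 JW _

variable {n : ℕ} (e : Fin N × Fin 1 ≃ Fin n) {TV : Matrix (Fin N) (Fin N) F} {TW : Matrix (Fin 1) (Fin 1) F}

/-- **the pair splitting takes the same value at `(1, g_∞)` and `((det_∞ g) · 1_V, 1)`** — no scalar appears.
[cite: GelbartRogawski1991, §3.1 p. 454–455, §3.2 p. 457] -/
theorem pairSplitting_one_archToAdelic_line (hJW : JW.det ≠ 0)
    (s : UnitaryGroup.adelicPair F E c N 1 JV JW →* adelicMpCont F (Fin n) (adelicGram F e TV TW))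
    (g : UnitaryGroup.arch F E c 1 JW) :
    pairSplitting F E c N 1 e JV JW s (1, UnitaryGroup.archToAdelic F E c 1 JW g) =
      pairSplitting F E c N 1 e JV JW s
        (UnitaryGroup.archToAdelic F E c N JV
          (UnitaryGroup.archCenter F E c N JV h2 hc (UnitaryGroup.archDet F E c 1 JW h2 hc hJW g)), 1) := by
  have key : UnitaryGroup.adelicInl F E c N 1 JV JW 1 *
        UnitaryGroup.adelicInr F E c N 1 JV JW (UnitaryGroup.archToAdelic F E c 1 JW g) =
      UnitaryGroup.adelicInl F E c N 1 JV JW (UnitaryGroup.archToAdelic F E c N JV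
          (UnitaryGroup.archCenter F E c N JV h2 hc (UnitaryGroup.archDet F E c 1 JW h2 hc hJW g))) *
        UnitaryGroup.adelicInr F E c N 1 JV JW 1 := by
    rw [map_one, map_one, one_mul, mul_one, adelicInr_archToAdelic_line F E c h2 hc N JV JW hJW g]
  exact congrArg s key

/-! ## §3 The archimedean Weil representation: `archWeilRep (1, g) = archWeilRep (det_∞ g · 1_V, 1)` -/

section Arch

variable [Algebra.IsQuadraticExtension F E] {δ : E} (hcδ : c δ = -δ) (hδ : δ ≠ 0) {d : F} (hd : δ * δ = algebraMap F E d)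
  (hV : TV.IsSymm) (hW : TW.IsSymm) (hVd : IsUnit TV.det) (hWd : IsUnit TW.det)
  (hJV : JV = TV.map (algebraMap F E)) (hJW' : JW = TW.map (algebraMap F E))
  (s : UnitaryGroup.adelicPair F E c N 1 JV JW →* adelicMpCont F (Fin n) (adelicGram F e TV TW))
  (hs : ∀ g, adelicMpCont.proj F (Fin n) (adelicGram F e TV TW) (s g) = toSp F E c N 1 e JV JW hcδ hδ hd hV hW hJV hJW' g)

set_option maxHeartbeats 800000 in
/-- **`archWeilRep s (1, g) = archWeilRep s ((det_∞ g) · 1_V, 1)`** for every `g ∈ U(J_W)(E ⊗ ℝ)`, `W` a line: the archimedean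
`U(W)`-torus acts through the archimedean centre of `U(V)` (`archWeilRep u = archPart ω(s_pair u_∞)` only sees `s_pair u_∞`).
[cite: Weil1964, Chap. III n° 37–38] [cite: GelbartRogawski1991, §3.1 p. 454–455] -/
theorem archWeilRep_one_line (hJW : JW.det ≠ 0) (g : UnitaryGroup.arch F E c 1 JW) :
    archWeilRep F E c N 1 JV JW hcδ hδ hd hV hW hVd hWd hJV hJW' e s hs (1, g) =
      archWeilRep F E c N 1 JV JW hcδ hδ hd hV hW hVd hWd hJV hJW' e s hs
        (UnitaryGroup.archCenter F E c N JV h2 hc (UnitaryGroup.archDet F E c 1 JW h2 hc hJW g), 1) := by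
  have h1 : archProdHom F E c N 1 JV JW (1, g) = (1, UnitaryGroup.archToAdelic F E c 1 JW g) :=
    Prod.ext (show UnitaryGroup.archToAdelic F E c N JV 1 = 1 from map_one _) rfl
  have h2' : archProdHom F E c N 1 JV JW
        (UnitaryGroup.archCenter F E c N JV h2 hc (UnitaryGroup.archDet F E c 1 JW h2 hc hJW g), 1) =
      (UnitaryGroup.archToAdelic F E c N JV
        (UnitaryGroup.archCenter F E c N JV h2 hc (UnitaryGroup.archDet F E c 1 JW h2 hc hJW g)), 1) :=
    Prod.ext rfl (show UnitaryGroup.archToAdelic F E c 1 JW 1 = 1 from map_one _)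
  have key : ((pairSplitting F E c N 1 e JV JW s).comp (archProdHom F E c N 1 JV JW)) (1, g) =
      ((pairSplitting F E c N 1 e JV JW s).comp (archProdHom F E c N 1 JV JW))
        (UnitaryGroup.archCenter F E c N JV h2 hc (UnitaryGroup.archDet F E c 1 JW h2 hc hJW g), 1) :=
    ((congrArg (pairSplitting F E c N 1 e JV JW s) h1).trans
      (pairSplitting_one_archToAdelic_line F E c h2 hc N JV JW e hJW s g)).trans
      (congrArg (pairSplitting F E c N 1 e JV JW s) h2').symm
  have step : ∀ u u' : UnitaryGroup.arch F E c N JV × UnitaryGroup.arch F E c 1 JW,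
      ((pairSplitting F E c N 1 e JV JW s).comp (archProdHom F E c N 1 JV JW)) u =
        ((pairSplitting F E c N 1 e JV JW s).comp (archProdHom F E c N 1 JV JW)) u' →
      archWeilRep F E c N 1 JV JW hcδ hδ hd hV hW hVd hWd hJV hJW' e s hs u =
        archWeilRep F E c N 1 JV JW hcδ hδ hd hV hW hVd hWd hJV hJW' e s hs u' := fun u u' huu' => by
    unfold archWeilRep
    rw [archRepMp_apply, archRepMp_apply]
    exact congrArg (fun p => archPart (adelicMpCont.omega F (Fin n) (adelicGram F e TV TW) p)) huu'
  exact step _ _ key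

/-! ## §4 Consumer forms for the head's `heig` -/

/-- **`heig` from the centre**: if the archimedean CENTRE of `U(J_V)` acts on `Φ_∞` by a character `χ_c` of `U(1)(F ⊗ ℝ)`, then
`U(J_W)(E ⊗ ℝ)` acts on `Φ_∞` by `χ_c ∘ det_∞`. [cite: Liu2021, App. D §D.1 Step 3 (l. 5219–5221)] [cite: GelbartRogawski1991, §3.1 p. 454–455] -/
theorem archWeilRep_one_line_eq_smul_of_center {Φ : SchwartzMap (Fin n → mixedEmbedding.mixedSpace F) ℂ} {χc : relNormOneInfUnits F E → ℂ}
    (hC : ∀ y : relNormOneInfUnits F E,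
      archWeilRep F E c N 1 JV JW hcδ hδ hd hV hW hVd hWd hJV hJW' e s hs (UnitaryGroup.archCenter F E c N JV h2 hc y, 1) Φ =
        χc y • Φ)
    (hJW : JW.det ≠ 0) (g : UnitaryGroup.arch F E c 1 JW) :
    archWeilRep F E c N 1 JV JW hcδ hδ hd hV hW hVd hWd hJV hJW' e s hs (1, g) Φ =
      χc (UnitaryGroup.archDet F E c 1 JW h2 hc hJW g) • Φ := by
  rw [archWeilRep_one_line F E c h2 hc N JV JW e hcδ hδ hd hV hW hVd hWd hJV hJW' s hs hJW g, hC]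

/-- **(A) from the centre**: if the archimedean centre of `U(J_V)` FIXES `Φ_∞`, then all of `U(J_W)(E ⊗ ℝ)` fixes `Φ_∞` under
`archWeilRep s (1, ·)`. [cite: Liu2021, App. D §D.1 Step 3 (l. 5219–5221); Lem. D.2] [cite: GelbartRogawski1991, §3.1 p. 454–455] -/
theorem archWeilRep_one_line_eq_self_of_center {Φ : SchwartzMap (Fin n → mixedEmbedding.mixedSpace F) ℂ}
    (hC : ∀ y : relNormOneInfUnits F E,
      archWeilRep F E c N 1 JV JW hcδ hδ hd hV hW hVd hWd hJV hJW' e s hs (UnitaryGroup.archCenter F E c N JV h2 hc y, 1) Φ = Φ)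
    (hJW : JW.det ≠ 0) (g : UnitaryGroup.arch F E c 1 JW) :
    archWeilRep F E c N 1 JV JW hcδ hδ hd hV hW hVd hWd hJV hJW' e s hs (1, g) Φ = Φ := by
  rw [archWeilRep_one_line F E c h2 hc N JV JW e hcδ hδ hd hV hW hVd hWd hJV hJW' s hs hJW g, hC]

/-- the same in the head's literal shape `ω_∞ a Φ_∞ = χ_∞ a • Φ_∞` with the TRIVIAL character `χ_∞ = 1`.
[cite: Liu2021, App. D §D.1 Step 3 (l. 5219–5221); Lem. D.2] -/
theorem archWeilRep_one_line_eq_one_smul_of_center {Φ : SchwartzMap (Fin n → mixedEmbedding.mixedSpace F) ℂ}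
    (hC : ∀ y : relNormOneInfUnits F E,
      archWeilRep F E c N 1 JV JW hcδ hδ hd hV hW hVd hWd hJV hJW' e s hs (UnitaryGroup.archCenter F E c N JV h2 hc y, 1) Φ = Φ)
    (hJW : JW.det ≠ 0) (g : UnitaryGroup.arch F E c 1 JW) :
    archWeilRep F E c N 1 JV JW hcδ hδ hd hV hW hVd hWd hJV hJW' e s hs (1, g) Φ =
      (fun _ : UnitaryGroup.arch F E c 1 JW => (1 : ℂ)) g • Φ := by
  rw [one_smul]
  exact archWeilRep_one_line_eq_self_of_center F E c h2 hc N JV JW e hcδ hδ hd hV hW hVd hWd hJV hJW' s hs hC hJW g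

end Arch

end Summit.HodgeConjecture.HodgeConjecture.Cruxes.H413.ThetaNonvanishing

end
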